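import Literature.NumberTheory.IwasawaTheory.ClassicalMuVanishesPExtensionAscentOdd
import Literature.NumberTheory.IwasawaTheory.ClassNumberPExpZeroCyclotomicSubfield
import Literature.NumberTheory.NumberFields.CyclotomicFieldsSevenNineClassNumber
import HarnessLib

/-!
# `μ_p = 0` for every finite Galois `p`-extension of a REGULAR `p`-th cyclotomic field (`p` odd; `p ∈ {3, 5, 7}` fact-free):
# Kummer towers `ℚ(ζ_p) ⊆ K'` with `Gal(K'/ℚ(ζ_p))` a `p`-group (proved; no definition, no named fact, no Ferrero–Washington)

`Proofs`-style file (theorems only) in topic `NumberTheory/IwasawaTheory` (namespace `Literature.NumberTheory.IwasawaTheory`), written by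
the prover seat `bsd-potss-rkm` g42 (cell `bsd-potss`; library pass, sequel of `ClassicalMuVanishesPExtensionAscentOdd.lean`).

Base: a `p`-th cyclotomic field `K ≅ ℚ(ζ_p)` with `p ∤ h(K)` has `μ = 0` (indeed `e_n = 0`) for every `ℤ_p`-extension (Iwasawa 1956; tree
`classicalMuVanishes_of_isCyclotomicExtension_prime`), and `κ ∘ res_{K/ℚ}` is onto because `p ∤ [K:ℚ] = p − 1`.  Step: the `p`-power
Galois ascent `classicalMuVanishes_restrict_of_restrict_of_isGalois_of_finrank_eq_prime_pow_odd`.  Hence, for `κ` a cyclotomic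
`ℤ_p`-extension of `ℚ` (`p` odd) and `K'/K` Galois of degree `p^m` with `κ ∘ res_{K'/ℚ}` onto (`K' ∩ ℚ(ζ_{p^∞}) = K`):
**`ClassicalMuVanishes (κ|_{K'})`** — e.g. the Kummer fields `ℚ(ζ_p, a^{1/p})`, the `p`-division fields `ℚ(E[p]) ⊇ ℚ(ζ_p)` of elliptic curves
with a rational `p`-torsion point (degree `p` or `1` over `ℚ(ζ_p)`), and towers of such steps.  For `p = 3, 5, 7` the regularity hypothesis is a
tree theorem (`h(ℚ(ζ_p)) = 1`), so the statements are unconditional.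

* `classicalMuVanishes_restrict_of_isCyclotomicExtension_prime_of_finrank_eq_prime_pow_odd` (regular `p`);
* `…_three`, `…_five`, `…_seven` (fact-free specialisations).

HONEST SCOPE.  Elementary given the previous files; nothing about elliptic curves or BSD is asserted (the division-field example is a
remark: supplying `κ ∘ res` onto and the degree for `ℚ(E[p])` is left to the user); no K9/KT row of cell `bsd-potss` consumes this file.

References: [Iwasawa1973MuInvariants] Thm. 2–3; [Iwasawa1956]; [Washington1997] §13.3 Prop. 13.23, §11.5 (class numbers of small
cyclotomic fields); [Lang1990] Ch. 13 §4.
-/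

set_option autoImplicit false

noncomputable section

open scoped NumberField Classical
open NumberField Field IntermediateField IsDedekindDomain Module

namespace Literature.NumberTheory.IwasawaTheory

open Literature.NumberTheory.EllipticCurves Literature.NumberTheory.EllipticCurves.ZpExtension
  Literature.NumberTheory.GaloisRepresentations Literature.NumberTheory.NumberFields

variable {p : ℕ} [hp : Fact p.Prime]

/-- **`μ_p = 0` for every finite Galois `p`-extension of a regular `p`-th cyclotomic field inside the cyclotomic tower.**  `p` odd, `κ` a
cyclotomic `ℤ_p`-extension of `ℚ`, `K` a `p`-th cyclotomic extension of `ℚ` with `p ∤ h(K)`, `K'/K` Galois of degree `p^m` with `κ ∘ res_{K'/ℚ}`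
onto: `ClassicalMuVanishes (κ|_{K'})`. [cite: Iwasawa1973MuInvariants, Thm. 2–3 (ℓ odd)] [cite: Washington1997, §13.3 Prop. 13.23 and Thm. 7.15 (comparison)] -/
theorem classicalMuVanishes_restrict_of_isCyclotomicExtension_prime_of_finrank_eq_prime_pow_odd (hodd : p ≠ 2)
    {κ : ZpExtension ℚ p} (hκ : κ.IsCyclotomic) (K : Type) [Field K] [NumberField K] [IsCyclotomicExtension {p} ℚ K]
    (hreg : ¬ p ∣ NumberField.classNumber K) (m : ℕ) (K' : Type) [Field K'] [NumberField K'] [Algebra K K']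
    [IsScalarTower ℚ K K'] [IsGalois K K'] (hdeg : Module.finrank K K' = p ^ m)
    (hK' : Function.Surjective (κ.toContinuousMonoidHom.comp (absGaloisRestrict ℚ K'))) :
    ClassicalMuVanishes (κ.restrict K' hK') := by
  have hK : Function.Surjective (κ.toContinuousMonoidHom.comp (absGaloisRestrict ℚ K)) :=
    surjective_comp_absGaloisRestrict_of_tower κ K K' hK'
  exact classicalMuVanishes_restrict_of_restrict_of_isGalois_of_finrank_eq_prime_pow_odd hodd hκ m K K' hdeg hK hK'
    (classicalMuVanishes_of_isCyclotomicExtension_prime p K hreg (κ.restrict K hK))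

/-- **`p = 3`, fact-free**: every finite Galois `3`-extension `K'` of a third cyclotomic field `K ≅ ℚ(√−3)` with `κ ∘ res` onto has
`μ₃ = 0` (`h(K) = 1`). [cite: Iwasawa1973MuInvariants, Thm. 2–3] [cite: Washington1997, §11.5 (h(ℚ(ζ₃)) = 1)] -/
theorem classicalMuVanishes_restrict_of_isCyclotomicExtension_three_of_finrank_eq_pow [Fact (3 : ℕ).Prime]
    {κ : ZpExtension ℚ 3} (hκ : κ.IsCyclotomic) (K : Type) [Field K] [NumberField K] [IsCyclotomicExtension {3} ℚ K]
    (m : ℕ) (K' : Type) [Field K'] [NumberField K'] [Algebra K K'] [IsScalarTower ℚ K K'] [IsGalois K K']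
    (hdeg : Module.finrank K K' = 3 ^ m)
    (hK' : Function.Surjective (κ.toContinuousMonoidHom.comp (absGaloisRestrict ℚ K'))) :
    ClassicalMuVanishes (κ.restrict K' hK') :=
  classicalMuVanishes_restrict_of_isCyclotomicExtension_prime_of_finrank_eq_prime_pow_odd (by decide) hκ K
    (by rw [classNumber_eq_one_of_isCyclotomicExtension_three K]; decide) m K' hdeg hK'

/-- **`p = 5`, fact-free**: every finite Galois `5`-extension `K'` of a fifth cyclotomic field `K ≅ ℚ(ζ₅)` with `κ ∘ res` onto has
`μ₅ = 0` (`h(K) = 1`). [cite: Iwasawa1973MuInvariants, Thm. 2–3] [cite: Washington1997, §11.5 (h(ℚ(ζ₅)) = 1)] -/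
theorem classicalMuVanishes_restrict_of_isCyclotomicExtension_five_of_finrank_eq_pow [Fact (5 : ℕ).Prime]
    {κ : ZpExtension ℚ 5} (hκ : κ.IsCyclotomic) (K : Type) [Field K] [NumberField K] [IsCyclotomicExtension {5} ℚ K]
    (m : ℕ) (K' : Type) [Field K'] [NumberField K'] [Algebra K K'] [IsScalarTower ℚ K K'] [IsGalois K K']
    (hdeg : Module.finrank K K' = 5 ^ m)
    (hK' : Function.Surjective (κ.toContinuousMonoidHom.comp (absGaloisRestrict ℚ K'))) :
    ClassicalMuVanishes (κ.restrict K' hK') :=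
  classicalMuVanishes_restrict_of_isCyclotomicExtension_prime_of_finrank_eq_prime_pow_odd (by decide) hκ K
    (by rw [classNumber_eq_one_of_isCyclotomicExtension_five K]; decide) m K' hdeg hK'

/-- **`p = 7`, fact-free**: every finite Galois `7`-extension `K'` of a seventh cyclotomic field `K ≅ ℚ(ζ₇)` with `κ ∘ res` onto has
`μ₇ = 0` (`h(K) = 1`, tree `classNumber_eq_one_of_isCyclotomicExtension_seven`). [cite: Iwasawa1973MuInvariants, Thm. 2–3]
[cite: Washington1997, §11.5 (h(ℚ(ζ₇)) = 1)] -/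
theorem classicalMuVanishes_restrict_of_isCyclotomicExtension_seven_of_finrank_eq_pow [Fact (7 : ℕ).Prime]
    {κ : ZpExtension ℚ 7} (hκ : κ.IsCyclotomic) (K : Type) [Field K] [NumberField K] [hK7 : IsCyclotomicExtension {7} ℚ K]
    (m : ℕ) (K' : Type) [Field K'] [NumberField K'] [Algebra K K'] [IsScalarTower ℚ K K'] [IsGalois K K']
    (hdeg : Module.finrank K K' = 7 ^ m)
    (hK' : Function.Surjective (κ.toContinuousMonoidHom.comp (absGaloisRestrict ℚ K'))) :
    ClassicalMuVanishes (κ.restrict K' hK') :=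
  classicalMuVanishes_restrict_of_isCyclotomicExtension_prime_of_finrank_eq_prime_pow_odd (by decide) hκ K
    (by rw [classNumber_eq_one_of_isCyclotomicExtension_seven K hK7]; decide) m K' hdeg hK'

end Literature.NumberTheory.IwasawaTheory

end
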